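import Literature.MathematicalPhysics.QuantumFieldTheory.Balaban1983to89.B6BlockDecayGDivBridgeV1
import Literature.MathematicalPhysics.QuantumFieldTheory.Balaban1983to89.B6BlockHolderCalculus

/-!
# `Balaban1983to89.B6BlockHolderGDivGEV1` — T. Bałaban, *Propagators and renormalization transformations for lattice gauge theories. II*,
# Commun. Math. Phys. **96** (1984) 223–250 [Balaban1984PropagatorsII], Prop. 2.5 p. 246 with [4] = *… I*, CMP **95** (1984) Prop. 1.2
# (1.111) p. 35: towards the HÖLDER member `‖ζG∇*J‖_α` of (1.111) for the two-scale `G` of (2.90) — the factor `G^{(w′)}∇_λ*`: [4] PROPOSITION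
# 1.2, MEMBER `‖ζG∇*J‖_α`, FOR `G_k` BY NAME (B5's torus family of record, tensor sources) and its transport to a PAIR (Hölder-in-the-output)
# block bound on the two-scale carriers — file 6 of the Hölder programme (p38); the Hölder twin of p22's `B6BlockDecayGDivBridgeV1`

statement-level skeleton of published theorems with citation tags; proofs where landed; nothing here is a claim about the Yang–Mills mass gap

[4] p. 35 (verbatim, as quoted in the tree's `B5.Prop12Printed`): *"‖ζ∇GJ‖_α, ‖ζG∇*J‖_α ≤ O(1)e^{−δ₀|y−y′|}(‖ζ‖_α + |ζ|)|J| (1.111) for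
0 ≤ α < 1, ζ ∈ C₀^∞(Δ̃(y)), supp J ⊂ Δ̃(y′), with the constant O(1) depending on d and α (O(1) → ∞ if α → 1)"*; (1.109): *"‖A‖_α =
max_μ sup_{x,x′:|x−x′|≤1} |x−x′|^{−α}|A_μ(x) − A_μ(x′)|"*; [B6] p. 246: *"They follow from the Proposition 1.2 …"*.

WHAT THIS FILE DOES.  §1 [4] PROPOSITION 1.2, THE MEMBER `‖ζG∇*J‖_α` OF (1.111) FOR `G_k = Δ_a⁻¹` ON B5's CARRIERS, ALL TORI, ALL SCALES
`1 ≤ k ≤ m + K`, HYPOTHESIS-FREE (`h1L_allScales`: the tree's Prop. 1.2 on B5's torus family of record `…B5Prop12GHolds.prop12_famG_printed`,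
member `h1` = r02's `h1L`, genuine on tensor sources: `h1L a (.ten T) α ζ = ‖ζ·G_k∇*T‖_α` (`B5Prop12FieldsLattice.h1L_ten`), re-indexed by p19's
`famG_reindex`).  §2 THE VALUE DICTIONARY (`GE_Dadj_apply_eq`): at `c = L^j`, `w′ = a·n^{d+1}`, `(G^{(w′)}∇_λ*x)(b₀) = Re (G_k∇*T)(EK b₀₋, μ(b₀))`
for the tensor source `T_ν = δ_{νλ}x^c` (p22's `srcC_Dadj_eq_divT`, r03's `GE_apply_eq_sum_Gk`, p19's `Gk_mulVec_apply`); its support and sup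
norm (`suppInL_srcT`, `supNormL_srcT_le`).  §3 CLOSE PAIRS (`abs_GE_Dadj_sub_le_close`): for fine bonds `b₁ = ⟨x, ν⟩`, `b₂ = ⟨x′, ν⟩` with
`0 < |x − x′| ≤ ¼` (unit of `T₁^{(j)}`) and `x` supported over the block `B^j(y′)`, `|x| ≤ X`:
`|(G^{(w′)}∇_λ*x)(b₁) − (G^{(w′)}∇_λ*x)(b₂)| ≤ max(O(1)(α),0)(Lθ+1)e^{3δ₀}·e^{−δ₀|y(x) − y′|}·X·|x − x′|^α` — r02's plateau cut-off
`χ = cutP(nearOf(EK x))` (`= 1` at both points, `‖χ‖_α + |χ| ≤ Lθ + 1`, supported in one cube; p19's route `…BIJ85Prop12BridgeHolder`), the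
product (1.111) of §1, r19's `holder_bound`.  §4 THE PAIR BOUND (`holderBound_GEDadj_scaling`): there is `δ > 0` (on `d, L, a`) and for every
`0 ≤ α < 1` a `C_α ≥ 0` with `Σ_{b₀′ : y(b₀′₋) = y}|(G^{(w′)}∇_λ*)(e_{b₀′})_{b₁} − (G^{(w′)}∇_λ*)(e_{b₀′})_{b₂}| ≤ C_α·t^α·e^{−δ|y(x) − y|_T}`,
`t = |x − x′|_∞/n ≤ 1` — close pairs by §3 on test vectors (file 1's `holderBound_of_cubeSup`), far pairs (`t > ¼`, `t^{−α} ≤ 4`) by p22's block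
bound `blockBound_GEDadj_scaling` twice (file 1's `holderBound_of_blockBound`); the close regime forces `n ≥ 4`, so scale `0` never needs (1.111).

HONEST SCOPE / DIVERGENCES. (1) `∇_λ*` = the `ℓ²`-adjoint of the forward difference with the factor `η⁻¹ = L^j` (p22 file 12); the printed
`G∇*J = GΣ_ν∇_ν*J_ν` is recovered component by component. (2) Only pairs of bonds with the same direction and `|x − x′|_∞ ≤ n`, as in (1.109).
(3) Constants ours. (4) No new definition, no new hypothesis: [4] Prop. 1.2 (B5's family), r02's/r03's/p19's/p22's dictionaries BY NAME.
NOT summit progress.  Unit `lit-balaban-p38` (gen 21), 2026-08-22.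
-/

noncomputable section

open scoped InnerProductSpace BigOperators Matrix
open Finset

namespace Literature.MathematicalPhysics.QuantumFieldTheory.Balaban1983to89.B6BlockHolderGDivGEV1

open LatticeFieldCalculus B5SectBStatements B5Eq117TorusCarriers B6SectADomainsV1 B6SectAOperatorsV1 B6SectAVectorModelV1 B6SectCOperators
  B6SectCTwoScaleV1 B6SectCTwoScaleV1Lattice B5Eq118OneStroke
open BalabanImbrieJaffe1984to88.BIJ85AxialPropagator411 (BondSpace)
open B4Sect5Torus (IsPseudoDist SumBound)
open B4TorusKernel.MultiPeriod (torusSupNorm torusSupNorm_nonneg)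
open B3TorusRadialSums (supDist_eq_zero_iff)
open B5Prop11Plancherel (Tor fine unitVec)
open B5Prop11Lattice (divT)
open B5Prop11SettingModel (Loc189)
open B5DeltaA169 (DeltaA)
open B5Prop12FieldsLattice (distSite distU cubeT cubeB suppInL supNormL cutInL cutHL h1L holderV smulV)
open B5SettingP12Real (LocR latticeSettingP12R)
open B5Prop12GLattice (famG)
open B5CoverP12Lattice (cutP nearOf Lθ Lθ_nonneg cutInL_cutP cutP_nearOf_eq_one_of_distU_le cutP_nearOf_eq_one mem_cubeT_nearOf)
open B5RowSumsP12Lattice (distSite_triangle)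
open B6LowerBound2153Torus (rep)
open B6HjGtOpNormV1 (qpE_whole_eq_zero_iff inner_QE_aE_whole)
open B6GOneLevelV1Bridge (GE_apply_eq_sum_Gk)
open B6BlockDecayCalculus (torusDist_isPseudoDist)
open B6BlockDecayHprimeCovV1 (supDist_cast_eq_torusSupNorm eq_of_torusDist_le_zero)
open B6BlockDecayGDivBridgeV1 (srcC_Dadj_eq_divT blockBound_GEDadj_scaling)
open B6BlockHolderCalculus (holderBound_of_cubeSup holderBound_of_blockBound self_le_rpow_of_le_one')
open BalabanImbrieJaffe1984to88.BIJ85Ineq722DeltaA (Gk)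
open BalabanImbrieJaffe1984to88.BIJ85Ineq722Torus (supDist_blk_le_one)
open BalabanImbrieJaffe1984to88.BIJ85Prop12BridgeGeometry (supDist_cast_eq_distSite EK_mem_cubeT_blk distU_EK distSite_le_three_of_mem_mem two_le_Mk)
open BalabanImbrieJaffe1984to88.BIJ85Prop12BridgeSup (srcC srcC_apply Gk_mulVec_apply)
open BalabanImbrieJaffe1984to88.BIJ85Prop12AllTori (famG_reindex)
open LatticeNorms (supNorm supNorm_le supNorm_nonneg holder_bound holderSeminorm_nonneg)

/-! ## §1  [4] Proposition 1.2, the member `‖ζG∇*J‖_α` of (1.111), on B5's carriers: all tori, all scales `k ≥ 1` -/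

section AllScales

/-- **[4] PROPOSITION 1.2, THE HÖLDER MEMBER (1.111) FOR `G_k = Δ_a⁻¹`, ALL TORI OF DIMENSION `d` AND BLOCK SIZE `L`, ALL SCALES `1 ≤ k ≤ m + K`,
HYPOTHESIS-FREE**: ONE `δ₀ > 0` and ONE `O(1)(α)` (depending on `d, L, a` only) such that for every torus `P` (`P.d = d`, `P.L = L`), every
`1 ≤ k ≤ m + K`, every `0 ≤ α < 1`, every real source `J` with `supp J ⊂ Δ̃(y′)` and cut-off `ζ` supported in `Δ̃(y)` (B5's cubes):
`h1 J α ζ ≤ O(1)(α)e^{−δ₀|y−y′|}(‖ζ‖_α + |ζ|)|J|` on B5's carriers (r02's `h1L`: `‖ζ∇G_kJ‖_α` on vector sources, `‖ζG_k∇*J‖_α` on tensor sources) —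
the tree's Prop. 1.2 on B5's torus family of record (`prop12_famG_printed`, member `h1`, p19's `famG_reindex`).
[cite: Balaban1984PropagatorsI, Prop. 1.2 (1.111) p.35, pp.39–40 («Thus we have finished the proof of Proposition 1.2.»)] -/
theorem h1L_allScales (d L : ℕ) {a : ℝ} (ha : 0 < a) :
    ∃ δ : ℝ, 0 < δ ∧ ∃ Cα : ℝ → ℝ, ∀ (P : Params) (_ : P.d = d) (_ : P.L = L) (k : ℕ) (_ : 1 ≤ k) (_ : k ≤ P.m + P.K)
      (α : ℝ) (J : LocR (P.L ^ k) (Mk P k)) (ζ : Tor (fine (P.L ^ k) (Mk P k)) → ℝ) (y y' : Tor (Mk P k)),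
      0 ≤ α → α < 1 → cutInL (P.L ^ k) (Mk P k) ζ y → suppInL (P.L ^ k) (Mk P k) J.emb y' →
      h1L (P.L ^ k) (Mk P k) a J.emb α ζ ≤
        Cα α * Real.exp (-(δ * distSite (Mk P k) y y')) * cutHL (P.L ^ k) (Mk P k) α ζ * supNormL (P.L ^ k) (Mk P k) J.emb := by
  by_cases h : 1 ≤ d ∧ (Odd L ∧ 1 < L)
  · obtain ⟨δ₁, C₁, Cα₁, Cε₁, Cαε₁, hδ₁, hC₁, H₁⟩ := B5Prop12GHolds.prop12_famG_printed (d := d) (L := L) h.1 h.2 ha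
    refine ⟨δ₁, hδ₁, Cα₁, ?_⟩
    intro P hPd hPL k hk1 hk α J ζ y y' hα0 hα1 hζ hJ
    subst hPd; subst hPL
    have H := H₁ ⟨⟨P.d, P.L, P.m + P.K - k, k, P.hd, P.hL⟩, rfl, rfl, hk1⟩
    rw [famG_reindex] at H
    obtain ⟨-, Hh, -, -, -⟩ := H
    exact Hh α J ζ y y' hα0 hα1 hζ hJ
  · -- no torus has `d = 0` or an inadmissible `L`: the range is empty
    refine ⟨1, one_pos, fun _ => 0, fun P hPd hPL k hk1 hk α J ζ y y' hα0 hα1 hζ hJ => ?_⟩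
    exact (h ⟨hPd ▸ P.hd, hPL ▸ P.hL⟩).elim

end AllScales

/-! ## §2  The value dictionary: `(G^{(w′)}∇_λ*x)(b₀) = Re (G_k∇*T)(EK b₀₋, μ(b₀))`, `T_ν = δ_{νλ}x^c` -/

section Transport

variable {d L m K : ℕ} [NeZero L] {hd : 1 ≤ d + 1} {hL : Odd L ∧ 1 < L} {j : ℕ}
  (hj' : j ≤ (⟨d + 1, L, m, K, hd, hL⟩ : Params).m + (⟨d + 1, L, m, K, hd, hL⟩ : Params).K)
  (hc : ((L : ℝ) ^ j) ≠ 0) {a : ℝ} (ha : 0 < a) (hw' : (0 : ℝ) < a * ((L : ℝ) ^ j) ^ (d + 1))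

include ha in
/-- **THE VALUE DICTIONARY**: at `c = L^j`, `w′ = a·n^{d+1}`, for a fine bond field `x` and a fine bond `b₀`,
`(G^{(w′)}∇_λ*x)(b₀) = Re (Δ_a⁻¹∇*T)(EK b₀₋, μ(b₀))` with the complexified tensor source `T_ν(b) = δ_{νλ}·x(EK⁻¹b₋, μ(b))` — r03's
`GE_apply_eq_sum_Gk` (`G^{(w′)}` IS p09's kernel `Gk`), p19's `Gk_mulVec_apply` (`Gk` IS r02's `Δ_a⁻¹` through `EK`), p22's `srcC_Dadj_eq_divT`
(the step inside p22's `abs_GE_Dadj_apply_le`, recorded as a lemma). [cite: Balaban1984PropagatorsI, (1.89) p.33 («G∇*J»); Balaban1984PropagatorsII, p.246] -/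
theorem GE_Dadj_apply_eq (lam : Fin (d + 1)) (x : BondSpace (⟨d + 1, L, m, K, hd, hL⟩ : Params)) (b₀ : PBond (⟨d + 1, L, m, K, hd, hL⟩ : Params) 0) :
    (GE (Domains.whole (P := (⟨d + 1, L, m, K, hd, hL⟩ : Params)) j hj') hc (w := fun _ => a * ((L : ℝ) ^ j) ^ (d + 1)) (fun _ => hw') ∘ₗ ((((L : ℝ) ^ j) • (onE (LinearMap.funLeft ℝ ℝ (fun b : PBond (⟨d + 1, L, m, K, hd, hL⟩ : Params) 0 => (⟨b.src.unshift lam, b.dir⟩ : PBond (⟨d + 1, L, m, K, hd, hL⟩ : Params) 0))) - LinearMap.id) : BondSpace (⟨d + 1, L, m, K, hd, hL⟩ : Params) →ₗ[ℝ] BondSpace (⟨d + 1, L, m, K, hd, hL⟩ : Params)))) x b₀ =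
      (((DeltaA (L ^ j) (Mk (⟨d + 1, L, m, K, hd, hL⟩ : Params) j) a)⁻¹ *ᵥ divT (L ^ j) (Mk (⟨d + 1, L, m, K, hd, hL⟩ : Params) j)
        (fun ν b => ((if ν = lam then x ⟨(EK hj').symm b.1, b.2⟩ else 0 : ℝ) : ℂ))) (EK hj' b₀.src, b₀.dir)).re := by
  classical
  rw [LinearMap.comp_apply, GE_apply_eq_sum_Gk hj' (Domains.whole (P := (⟨d + 1, L, m, K, hd, hL⟩ : Params)) j hj')
    (qpE_whole_eq_zero_iff hj') (fun _ => hw') ha (inner_QE_aE_whole hj' a) _ b₀]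
  have h1 : ∑ b' : PBond (⟨d + 1, L, m, K, hd, hL⟩ : Params) 0, Gk hj' a (b₀.src, b₀.dir) (b'.src, b'.dir) * (((((L : ℝ) ^ j) • (onE (LinearMap.funLeft ℝ ℝ (fun b : PBond (⟨d + 1, L, m, K, hd, hL⟩ : Params) 0 => (⟨b.src.unshift lam, b.dir⟩ : PBond (⟨d + 1, L, m, K, hd, hL⟩ : Params) 0))) - LinearMap.id) : BondSpace (⟨d + 1, L, m, K, hd, hL⟩ : Params) →ₗ[ℝ] BondSpace (⟨d + 1, L, m, K, hd, hL⟩ : Params)))) x b' =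
      (Gk hj' a *ᵥ fun jj : Site (⟨d + 1, L, m, K, hd, hL⟩ : Params) 0 × Fin (d + 1) => (((((L : ℝ) ^ j) • (onE (LinearMap.funLeft ℝ ℝ (fun b : PBond (⟨d + 1, L, m, K, hd, hL⟩ : Params) 0 => (⟨b.src.unshift lam, b.dir⟩ : PBond (⟨d + 1, L, m, K, hd, hL⟩ : Params) 0))) - LinearMap.id) : BondSpace (⟨d + 1, L, m, K, hd, hL⟩ : Params) →ₗ[ℝ] BondSpace (⟨d + 1, L, m, K, hd, hL⟩ : Params)))) x ⟨jj.1, jj.2⟩) (b₀.src, b₀.dir) := by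
    rw [Matrix.mulVec, dotProduct]
    exact (Fintype.sum_equiv (LatticeFieldCalculus.bondEquiv) _ _ fun jj => rfl).symm
  rw [h1, Gk_mulVec_apply, srcC_Dadj_eq_divT]

/-- the support of the tensor source `T_ν = δ_{νλ}x^c` of a fine bond field supported over the block `B^j(y′)`: `supp T ⊂ Δ̃(y′)` (B5's cube;
p19's `EK_mem_cubeT_blk`). [cite: Balaban1984PropagatorsI, Prop. 1.2 p.35 («supp J ⊂ Δ̃(y′)»)] -/
theorem suppInL_srcT (lam : Fin (d + 1)) (x : BondSpace (⟨d + 1, L, m, K, hd, hL⟩ : Params)) (y' : Site (⟨d + 1, L, m, K, hd, hL⟩ : Params) j)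
    (hsupp : ∀ b : PBond (⟨d + 1, L, m, K, hd, hL⟩ : Params) 0, x b ≠ 0 → iterBlockOf j b.src = y') :
    suppInL (L ^ j) (Mk (⟨d + 1, L, m, K, hd, hL⟩ : Params) j)
      (LocR.ten (fun ν b => if ν = lam then x ⟨(EK hj').symm b.1, b.2⟩ else 0) : LocR (L ^ j) (Mk (⟨d + 1, L, m, K, hd, hL⟩ : Params) j)).emb y' := by
  show suppInL (L ^ j) (Mk (⟨d + 1, L, m, K, hd, hL⟩ : Params) j) (Loc189.ten (fun ν b => ((if ν = lam then x ⟨(EK hj').symm b.1, b.2⟩ else 0 : ℝ) : ℂ))) y'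
  intro ν b hb
  have hν : ν = lam := by
    by_contra hν
    exact hb (by show (((if ν = lam then x ⟨(EK hj').symm b.1, b.2⟩ else 0 : ℝ) : ℂ)) = 0; rw [if_neg hν, Complex.ofReal_zero])
  have hxb : x ⟨(EK hj').symm b.1, b.2⟩ ≠ 0 := by
    intro h0
    exact hb (by show (((if ν = lam then x ⟨(EK hj').symm b.1, b.2⟩ else 0 : ℝ) : ℂ)) = 0; rw [if_pos hν, h0, Complex.ofReal_zero])
  have hblk : iterBlockOf j ((EK hj').symm b.1) = y' := hsupp _ hxb
  have hmem := EK_mem_cubeT_blk hj' ((EK hj').symm b.1)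
  rw [Equiv.apply_symm_apply, hblk] at hmem
  exact hmem

/-- the sup norm of the tensor source `T_ν = δ_{νλ}x^c`: `|T| ≤ X` if `|x| ≤ X`. [cite: Balaban1984PropagatorsI, (1.108) p.35] -/
theorem supNormL_srcT_le (lam : Fin (d + 1)) (x : BondSpace (⟨d + 1, L, m, K, hd, hL⟩ : Params)) {X : ℝ} (hX : 0 ≤ X) (hx : ∀ b : PBond (⟨d + 1, L, m, K, hd, hL⟩ : Params) 0, |x b| ≤ X) :
    supNormL (L ^ j) (Mk (⟨d + 1, L, m, K, hd, hL⟩ : Params) j)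
      (LocR.ten (fun ν b => if ν = lam then x ⟨(EK hj').symm b.1, b.2⟩ else 0) : LocR (L ^ j) (Mk (⟨d + 1, L, m, K, hd, hL⟩ : Params) j)).emb ≤ X := by
  show supNorm Finset.univ (fun p : Fin (d + 1) × (Tor (fine (L ^ j) (Mk (⟨d + 1, L, m, K, hd, hL⟩ : Params) j)) × Fin (d + 1)) =>
    ((if p.1 = lam then x ⟨(EK hj').symm p.2.1, p.2.2⟩ else 0 : ℝ) : ℂ)) ≤ X
  refine supNorm_le hX fun p _ => ?_
  rw [Complex.norm_real, Real.norm_eq_abs]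
  split_ifs
  · exact hx _
  · rw [abs_zero]; exact hX

/-! ## §3  Close pairs: the product (1.111) with the plateau cut-off -/

include ha in
/-- **THE DIFFERENCE OF `G^{(w′)}∇_λ*x` AT A CLOSE PAIR OF FINE BONDS**: if the Hölder member (1.111) holds on B5's carrier of scale `j` of this
torus at `(O(1)(·), δ₀)` (§1), then for fine bonds `b₁ = ⟨x, ν⟩`, `b₂ = ⟨x′, ν⟩` with `0 < |x − x′| ≤ ¼` (unit of `T₁^{(j)}`) and a fine bond
field `x` supported over the block `B^j(y′)` with `|x| ≤ X`:
`|(G^{(w′)}∇_λ*x)(b₁) − (G^{(w′)}∇_λ*x)(b₂)| ≤ max(O(1)(α),0)·(Lθ+1)·e^{3δ₀}·e^{−δ₀|y(x) − y′|_T}·X·|x − x′|^α` — r02's plateau cut-off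
`χ = cutP(nearOf(EK x))` is `1` at both points (`cutP_nearOf_eq_one`, `cutP_nearOf_eq_one_of_distU_le`), is supported in the cube of
`ỹ = nearOf(EK x)` (`cutInL_cutP`) with `‖χ‖_α + |χ| ≤ Lθ + 1` (`cutH_le`), so the pair is a pair of the field `χ·G_k∇*T` whose Hölder
seminorm is (1.111); `|ỹ − y(x)| ≤ 3` (`distSite_le_three_of_mem_mem`). [cite: Balaban1984PropagatorsI, Prop. 1.2 (1.111) p.35, (1.109) p.35] -/
theorem abs_GE_Dadj_sub_le_close {δ₀ : ℝ} (hδ : 0 ≤ δ₀) {Cα : ℝ → ℝ} {α : ℝ} (hα0 : 0 ≤ α) (hα1 : α < 1)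
    (H : ∀ (α : ℝ) (T : LocR (((⟨d + 1, L, m, K, hd, hL⟩ : Params).L) ^ j) (Mk (⟨d + 1, L, m, K, hd, hL⟩ : Params) j)) (ζ : Tor (fine (((⟨d + 1, L, m, K, hd, hL⟩ : Params).L) ^ j) (Mk (⟨d + 1, L, m, K, hd, hL⟩ : Params) j)) → ℝ) (y y' : Tor (Mk (⟨d + 1, L, m, K, hd, hL⟩ : Params) j)),
      0 ≤ α → α < 1 → cutInL (((⟨d + 1, L, m, K, hd, hL⟩ : Params).L) ^ j) (Mk (⟨d + 1, L, m, K, hd, hL⟩ : Params) j) ζ y → suppInL (((⟨d + 1, L, m, K, hd, hL⟩ : Params).L) ^ j) (Mk (⟨d + 1, L, m, K, hd, hL⟩ : Params) j) T.emb y' →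
      h1L (((⟨d + 1, L, m, K, hd, hL⟩ : Params).L) ^ j) (Mk (⟨d + 1, L, m, K, hd, hL⟩ : Params) j) a T.emb α ζ ≤
        Cα α * Real.exp (-(δ₀ * distSite (Mk (⟨d + 1, L, m, K, hd, hL⟩ : Params) j) y y')) * cutHL (((⟨d + 1, L, m, K, hd, hL⟩ : Params).L) ^ j) (Mk (⟨d + 1, L, m, K, hd, hL⟩ : Params) j) α ζ *
          supNormL (((⟨d + 1, L, m, K, hd, hL⟩ : Params).L) ^ j) (Mk (⟨d + 1, L, m, K, hd, hL⟩ : Params) j) T.emb)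
    (lam : Fin (d + 1)) (x : BondSpace (⟨d + 1, L, m, K, hd, hL⟩ : Params)) {X : ℝ} (hX : 0 ≤ X) (y' : Site (⟨d + 1, L, m, K, hd, hL⟩ : Params) j)
    (hsupp : ∀ b : PBond (⟨d + 1, L, m, K, hd, hL⟩ : Params) 0, x b ≠ 0 → iterBlockOf j b.src = y') (hx : ∀ b : PBond (⟨d + 1, L, m, K, hd, hL⟩ : Params) 0, |x b| ≤ X)
    (b₁ b₂ : PBond (⟨d + 1, L, m, K, hd, hL⟩ : Params) 0) (hdir : b₁.dir = b₂.dir)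
    (hpos : 0 < distU (L ^ j) (Mk (⟨d + 1, L, m, K, hd, hL⟩ : Params) j) (EK hj' b₁.src) (EK hj' b₂.src))
    (hclose : distU (L ^ j) (Mk (⟨d + 1, L, m, K, hd, hL⟩ : Params) j) (EK hj' b₁.src) (EK hj' b₂.src) ≤ 1 / 4) :
    |(GE (Domains.whole (P := (⟨d + 1, L, m, K, hd, hL⟩ : Params)) j hj') hc (w := fun _ => a * ((L : ℝ) ^ j) ^ (d + 1)) (fun _ => hw') ∘ₗ ((((L : ℝ) ^ j) • (onE (LinearMap.funLeft ℝ ℝ (fun b : PBond (⟨d + 1, L, m, K, hd, hL⟩ : Params) 0 => (⟨b.src.unshift lam, b.dir⟩ : PBond (⟨d + 1, L, m, K, hd, hL⟩ : Params) 0))) - LinearMap.id) : BondSpace (⟨d + 1, L, m, K, hd, hL⟩ : Params) →ₗ[ℝ] BondSpace (⟨d + 1, L, m, K, hd, hL⟩ : Params)))) x b₁ - (GE (Domains.whole (P := (⟨d + 1, L, m, K, hd, hL⟩ : Params)) j hj') hc (w := fun _ => a * ((L : ℝ) ^ j) ^ (d + 1)) (fun _ => hw') ∘ₗ ((((L : ℝ)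 ^ j) • (onE (LinearMap.funLeft ℝ ℝ (fun b : PBond (⟨d + 1, L, m, K, hd, hL⟩ : Params) 0 => (⟨b.src.unshift lam, b.dir⟩ : PBond (⟨d + 1, L, m, K, hd, hL⟩ : Params) 0))) - LinearMap.id) : BondSpace (⟨d + 1, L, m, K, hd, hL⟩ : Params) →ₗ[ℝ] BondSpace (⟨d + 1, L, m, K, hd, hL⟩ : Params)))) x b₂| ≤
      max (Cα α) 0 * (Lθ (d + 1) + 1) * Real.exp (3 * δ₀) *
        Real.exp (-(δ₀ * torusSupNorm (Mk (⟨d + 1, L, m, K, hd, hL⟩ : Params) j) (rep (Mk (⟨d + 1, L, m, K, hd, hL⟩ : Params) j) (iterBlockOf j b₁.src) - rep (Mk (⟨d + 1, L, m, K, hd, hL⟩ : Params) j) y'))) * X *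
        distU (L ^ j) (Mk (⟨d + 1, L, m, K, hd, hL⟩ : Params) j) (EK hj' b₁.src) (EK hj' b₂.src) ^ α := by
  classical
  have hL0 : 0 < L := Nat.pos_of_ne_zero (NeZero.ne L)
  have hn1 : 1 ≤ L ^ j := Nat.one_le_pow _ _ hL0
  have hle1 : distU (L ^ j) (Mk (⟨d + 1, L, m, K, hd, hL⟩ : Params) j) (EK hj' b₁.src) (EK hj' b₂.src) ≤ 1 := hclose.trans (by norm_num)
  -- the tensor source and the field `F = Δ_a⁻¹∇*T`
  obtain ⟨T, hT⟩ : ∃ T : LocR (L ^ j) (Mk (⟨d + 1, L, m, K, hd, hL⟩ : Params) j), T = LocR.ten (fun ν b => if ν = lam then x ⟨(EK hj').symm b.1, b.2⟩ else 0) := ⟨_, rfl⟩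
  have hTemb : T.emb = Loc189.ten (fun ν b => ((if ν = lam then x ⟨(EK hj').symm b.1, b.2⟩ else 0 : ℝ) : ℂ)) := by
    rw [hT]; rfl
  set F : Tor (fine (L ^ j) (Mk (⟨d + 1, L, m, K, hd, hL⟩ : Params) j)) × Fin (d + 1) → ℂ :=
    (DeltaA (L ^ j) (Mk (⟨d + 1, L, m, K, hd, hL⟩ : Params) j) a)⁻¹ *ᵥ divT (L ^ j) (Mk (⟨d + 1, L, m, K, hd, hL⟩ : Params) j)
      (fun ν b => ((if ν = lam then x ⟨(EK hj').symm b.1, b.2⟩ else 0 : ℝ) : ℂ)) with hF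
  -- the plateau cut-off around `EK x` covers both points
  set χ : Tor (fine (L ^ j) (Mk (⟨d + 1, L, m, K, hd, hL⟩ : Params) j)) → ℝ := cutP (Mk (⟨d + 1, L, m, K, hd, hL⟩ : Params) j) (L ^ j) (nearOf (Mk (⟨d + 1, L, m, K, hd, hL⟩ : Params) j) (L ^ j) (EK hj' b₁.src)) with hχ
  have hχ1 : χ (EK hj' b₁.src) = 1 := cutP_nearOf_eq_one (Mk (⟨d + 1, L, m, K, hd, hL⟩ : Params) j) (L ^ j) hn1 (EK hj' b₁.src)
  have hχ2 : χ (EK hj' b₂.src) = 1 := cutP_nearOf_eq_one_of_distU_le (Mk (⟨d + 1, L, m, K, hd, hL⟩ : Params) j) (L ^ j) hn1 hclose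
  -- the pair as a pair of the cut field `χF`, below its Hölder seminorm
  have hD : 0 < distU (L ^ j) (Mk (⟨d + 1, L, m, K, hd, hL⟩ : Params) j) (EK hj' b₁.src) (EK hj' b₂.src) ^ α := Real.rpow_pos_of_pos hpos α
  have hpair := holder_bound (adm := fun b b' : Tor (fine (L ^ j) (Mk (⟨d + 1, L, m, K, hd, hL⟩ : Params) j)) × Fin (d + 1) =>
      b.2 = b'.2 ∧ distU (L ^ j) (Mk (⟨d + 1, L, m, K, hd, hL⟩ : Params) j) b.1 b'.1 ≤ 1)
    (dist := fun b b' : Tor (fine (L ^ j) (Mk (⟨d + 1, L, m, K, hd, hL⟩ : Params) j)) × Fin (d + 1) => distU (L ^ j) (Mk (⟨d + 1, L, m, K, hd, hL⟩ : Params) j) b.1 b'.1)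
    (τ := fun _ _ => id) (S := Finset.univ) (α := α)
    (smulV (L ^ j) (Mk (⟨d + 1, L, m, K, hd, hL⟩ : Params) j) χ F) (x := (EK hj' b₁.src, b₁.dir)) (x' := (EK hj' b₂.src, b₂.dir)) (Finset.mem_univ _) (Finset.mem_univ _)
    ⟨hdir, hle1⟩ hpos
  dsimp only [id] at hpair
  -- `hpair : ‖χ(EK x′)F(EK x′, ν) − χ(EK x)F(EK x, ν)‖ ≤ holderV α (χF) * distU^α`
  have h1 : (GE (Domains.whole (P := (⟨d + 1, L, m, K, hd, hL⟩ : Params)) j hj') hc (w := fun _ => a * ((L : ℝ) ^ j) ^ (d + 1)) (fun _ => hw') ∘ₗ ((((L : ℝ) ^ j) • (onE (LinearMap.funLeft ℝ ℝ (fun b : PBond (⟨d + 1, L, m, K, hd, hL⟩ : Params) 0 => (⟨b.src.unshift lam, b.dir⟩ : PBond (⟨d + 1, L, m, K, hd, hL⟩ : Params) 0))) - LinearMap.id) : BondSpace (⟨d + 1, L, m, K, hd, hL⟩ : Params) →ₗ[ℝ] BondSpace (⟨d + 1, L, m, K, hd, hL⟩ : Params)))) x b₁ - (GE (Domains.whole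 (P := (⟨d + 1, L, m, K, hd, hL⟩ : Params)) j hj') hc (w := fun _ => a * ((L : ℝ) ^ j) ^ (d + 1)) (fun _ => hw') ∘ₗ ((((L : ℝ) ^ j) • (onE (LinearMap.funLeft ℝ ℝ (fun b : PBond (⟨d + 1, L, m, K, hd, hL⟩ : Params) 0 => (⟨b.src.unshift lam, b.dir⟩ : PBond (⟨d + 1, L, m, K, hd, hL⟩ : Params) 0))) - LinearMap.id) : BondSpace (⟨d + 1, L, m, K, hd, hL⟩ : Params) →ₗ[ℝ] BondSpace (⟨d + 1, L, m, K, hd, hL⟩ : Params)))) x b₂ =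
      (F (EK hj' b₁.src, b₁.dir) - F (EK hj' b₂.src, b₂.dir)).re := by
    rw [GE_Dadj_apply_eq hj' hc ha hw', GE_Dadj_apply_eq hj' hc ha hw', Complex.sub_re]
  have h2 : F (EK hj' b₁.src, b₁.dir) - F (EK hj' b₂.src, b₂.dir) =
      -(smulV (L ^ j) (Mk (⟨d + 1, L, m, K, hd, hL⟩ : Params) j) χ F (EK hj' b₂.src, b₂.dir) - smulV (L ^ j) (Mk (⟨d + 1, L, m, K, hd, hL⟩ : Params) j) χ F (EK hj' b₁.src, b₁.dir)) := by
    simp only [smulV, hχ1, hχ2, Complex.ofReal_one, one_mul, neg_sub]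
  rw [h1, h2]
  refine (Complex.abs_re_le_norm _).trans ?_
  rw [norm_neg]
  refine hpair.trans ?_
  -- the Hölder seminorm is r02's `h1L` of the tensor source, bounded by the product (1.111)
  have hH := H α T χ (nearOf (Mk (⟨d + 1, L, m, K, hd, hL⟩ : Params) j) (L ^ j) (EK hj' b₁.src)) y' hα0 hα1
    (cutInL_cutP (Mk (⟨d + 1, L, m, K, hd, hL⟩ : Params) j) (L ^ j) hn1 _) (by rw [hT]; exact suppInL_srcT hj' lam x y' hsupp)
  rw [hTemb, B5Prop12FieldsLattice.h1L_ten] at hH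
  have hcut : cutHL (L ^ j) (Mk (⟨d + 1, L, m, K, hd, hL⟩ : Params) j) α χ ≤ Lθ (d + 1) + 1 :=
    B5GlobCoverP12Lattice.cutH_le (Mk (⟨d + 1, L, m, K, hd, hL⟩ : Params) j) (L ^ j) (two_le_Mk (⟨d + 1, L, m, K, hd, hL⟩ : Params) j) α _ hα1
  have hTn : supNormL (L ^ j) (Mk (⟨d + 1, L, m, K, hd, hL⟩ : Params) j) (Loc189.ten (fun ν b => ((if ν = lam then x ⟨(EK hj').symm b.1, b.2⟩ else 0 : ℝ) : ℂ))) ≤ X := supNormL_srcT_le hj' lam x hX hx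
  have hE : 0 ≤ Real.exp (-(δ₀ * distSite (Mk (⟨d + 1, L, m, K, hd, hL⟩ : Params) j) (nearOf (Mk (⟨d + 1, L, m, K, hd, hL⟩ : Params) j) (L ^ j) (EK hj' b₁.src)) y')) := (Real.exp_pos _).le
  have hcut0 : 0 ≤ cutHL (L ^ j) (Mk (⟨d + 1, L, m, K, hd, hL⟩ : Params) j) α χ := B5Prop12FieldsLattice.cutHL_nonneg α χ
  have hT0 : 0 ≤ supNormL (L ^ j) (Mk (⟨d + 1, L, m, K, hd, hL⟩ : Params) j) (Loc189.ten (fun ν b => ((if ν = lam then x ⟨(EK hj').symm b.1, b.2⟩ else 0 : ℝ) : ℂ))) := B5Prop12FieldsLattice.supNormL_nonneg _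
  have hm : 0 ≤ max (Cα α) 0 := le_max_right _ _
  have hLθ : 0 ≤ Lθ (d + 1) := Lθ_nonneg (d + 1)
  -- the decay factor: `|ỹ − y′| ≥ |y(x) − y′| − 3`, `ỹ = nearOf (EK x)`
  have hyn : distSite (Mk (⟨d + 1, L, m, K, hd, hL⟩ : Params) j) (iterBlockOf j b₁.src) (nearOf (Mk (⟨d + 1, L, m, K, hd, hL⟩ : Params) j) (L ^ j) (EK hj' b₁.src)) ≤ 3 :=
    distSite_le_three_of_mem_mem hn1 (EK_mem_cubeT_blk hj' b₁.src) (mem_cubeT_nearOf (Mk (⟨d + 1, L, m, K, hd, hL⟩ : Params) j) (L ^ j) hn1 (EK hj' b₁.src))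
  have hdist : distSite (Mk (⟨d + 1, L, m, K, hd, hL⟩ : Params) j) (iterBlockOf j b₁.src) y' =
      torusSupNorm (Mk (⟨d + 1, L, m, K, hd, hL⟩ : Params) j) (rep (Mk (⟨d + 1, L, m, K, hd, hL⟩ : Params) j) (iterBlockOf j b₁.src) - rep (Mk (⟨d + 1, L, m, K, hd, hL⟩ : Params) j) y') := by
    rw [← supDist_cast_eq_distSite, supDist_cast_eq_torusSupNorm]
  have hexp : Real.exp (-(δ₀ * distSite (Mk (⟨d + 1, L, m, K, hd, hL⟩ : Params) j) (nearOf (Mk (⟨d + 1, L, m, K, hd, hL⟩ : Params) j) (L ^ j) (EK hj' b₁.src)) y')) ≤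
      Real.exp (3 * δ₀) * Real.exp (-(δ₀ * torusSupNorm (Mk (⟨d + 1, L, m, K, hd, hL⟩ : Params) j) (rep (Mk (⟨d + 1, L, m, K, hd, hL⟩ : Params) j) (iterBlockOf j b₁.src) - rep (Mk (⟨d + 1, L, m, K, hd, hL⟩ : Params) j) y'))) := by
    rw [← Real.exp_add, ← hdist]
    apply Real.exp_le_exp.mpr
    have ht := distSite_triangle (Mk (⟨d + 1, L, m, K, hd, hL⟩ : Params) j) (iterBlockOf j b₁.src) (nearOf (Mk (⟨d + 1, L, m, K, hd, hL⟩ : Params) j) (L ^ j) (EK hj' b₁.src)) y'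
    nlinarith
  have h3 : holderV (L ^ j) (Mk (⟨d + 1, L, m, K, hd, hL⟩ : Params) j) α (smulV (L ^ j) (Mk (⟨d + 1, L, m, K, hd, hL⟩ : Params) j) χ F) ≤
      max (Cα α) 0 * (Lθ (d + 1) + 1) * Real.exp (3 * δ₀) *
        Real.exp (-(δ₀ * torusSupNorm (Mk (⟨d + 1, L, m, K, hd, hL⟩ : Params) j) (rep (Mk (⟨d + 1, L, m, K, hd, hL⟩ : Params) j) (iterBlockOf j b₁.src) - rep (Mk (⟨d + 1, L, m, K, hd, hL⟩ : Params) j) y'))) * X :=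
    calc holderV (L ^ j) (Mk (⟨d + 1, L, m, K, hd, hL⟩ : Params) j) α (smulV (L ^ j) (Mk (⟨d + 1, L, m, K, hd, hL⟩ : Params) j) χ F)
        ≤ Cα α * Real.exp (-(δ₀ * distSite (Mk (⟨d + 1, L, m, K, hd, hL⟩ : Params) j) (nearOf (Mk (⟨d + 1, L, m, K, hd, hL⟩ : Params) j) (L ^ j) (EK hj' b₁.src)) y')) *
            cutHL (L ^ j) (Mk (⟨d + 1, L, m, K, hd, hL⟩ : Params) j) α χ * supNormL (L ^ j) (Mk (⟨d + 1, L, m, K, hd, hL⟩ : Params) j) (Loc189.ten (fun ν b => ((if ν = lam then x ⟨(EK hj').symm b.1, b.2⟩ else 0 : ℝ) : ℂ))) := hH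
      _ ≤ max (Cα α) 0 * Real.exp (-(δ₀ * distSite (Mk (⟨d + 1, L, m, K, hd, hL⟩ : Params) j) (nearOf (Mk (⟨d + 1, L, m, K, hd, hL⟩ : Params) j) (L ^ j) (EK hj' b₁.src)) y')) *
            cutHL (L ^ j) (Mk (⟨d + 1, L, m, K, hd, hL⟩ : Params) j) α χ * supNormL (L ^ j) (Mk (⟨d + 1, L, m, K, hd, hL⟩ : Params) j) (Loc189.ten (fun ν b => ((if ν = lam then x ⟨(EK hj').symm b.1, b.2⟩ else 0 : ℝ) : ℂ))) := by
          have h0 : 0 ≤ Real.exp (-(δ₀ * distSite (Mk (⟨d + 1, L, m, K, hd, hL⟩ : Params) j) (nearOf (Mk (⟨d + 1, L, m, K, hd, hL⟩ : Params) j) (L ^ j) (EK hj' b₁.src)) y')) *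
              cutHL (L ^ j) (Mk (⟨d + 1, L, m, K, hd, hL⟩ : Params) j) α χ * supNormL (L ^ j) (Mk (⟨d + 1, L, m, K, hd, hL⟩ : Params) j) (Loc189.ten (fun ν b => ((if ν = lam then x ⟨(EK hj').symm b.1, b.2⟩ else 0 : ℝ) : ℂ))) := by positivity
          have e1 : ∀ c : ℝ, c * Real.exp (-(δ₀ * distSite (Mk (⟨d + 1, L, m, K, hd, hL⟩ : Params) j) (nearOf (Mk (⟨d + 1, L, m, K, hd, hL⟩ : Params) j) (L ^ j) (EK hj' b₁.src)) y')) *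
              cutHL (L ^ j) (Mk (⟨d + 1, L, m, K, hd, hL⟩ : Params) j) α χ * supNormL (L ^ j) (Mk (⟨d + 1, L, m, K, hd, hL⟩ : Params) j) (Loc189.ten (fun ν b => ((if ν = lam then x ⟨(EK hj').symm b.1, b.2⟩ else 0 : ℝ) : ℂ))) =
              c * (Real.exp (-(δ₀ * distSite (Mk (⟨d + 1, L, m, K, hd, hL⟩ : Params) j) (nearOf (Mk (⟨d + 1, L, m, K, hd, hL⟩ : Params) j) (L ^ j) (EK hj' b₁.src)) y')) *
              cutHL (L ^ j) (Mk (⟨d + 1, L, m, K, hd, hL⟩ : Params) j) α χ * supNormL (L ^ j) (Mk (⟨d + 1, L, m, K, hd, hL⟩ : Params) j) (Loc189.ten (fun ν b => ((if ν = lam then x ⟨(EK hj').symm b.1, b.2⟩ else 0 : ℝ) : ℂ)))) := fun c => by ring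
          rw [e1, e1]
          exact mul_le_mul_of_nonneg_right (le_max_left _ _) h0
      _ ≤ max (Cα α) 0 * (Real.exp (3 * δ₀) *
            Real.exp (-(δ₀ * torusSupNorm (Mk (⟨d + 1, L, m, K, hd, hL⟩ : Params) j) (rep (Mk (⟨d + 1, L, m, K, hd, hL⟩ : Params) j) (iterBlockOf j b₁.src) - rep (Mk (⟨d + 1, L, m, K, hd, hL⟩ : Params) j) y')))) *
            (Lθ (d + 1) + 1) * X := by gcongr
      _ = _ := by ring
  exact mul_le_mul_of_nonneg_right h3 hD.le

end Transport

/-! ## §4  The pair bound of `G^{(w′)}∇_λ*` -/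

variable {d L m K : ℕ} {hd : 1 ≤ d + 1} {hL : Odd L ∧ 1 < L} {j : ℕ}

open Classical in
/-- **[4] PROPOSITION 1.2, (1.111) MEMBER `‖ζG∇*J‖_α`, FOR `G^{(w′)}∇_λ*` AS A PAIR (HÖLDER-IN-THE-OUTPUT) BLOCK BOUND** (`c = L^j`,
`w′ = a·n^{d+1}`): there is `δ > 0` depending on `d, L, a` only and, for every `0 ≤ α < 1`, a `C_α ≥ 0` such that for every volume, `j ≤ m + K`,
direction `λ`, fine bonds `b₁ = ⟨x, ν⟩`, `b₂ = ⟨x′, ν⟩` with `|x − x′|_∞ ≤ n` and unit site `y`: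
`Σ_{b₀′ : y(b₀′₋) = y}|(G^{(w′)}∇_λ*)(e_{b₀′})_{b₁} − (G^{(w′)}∇_λ*)(e_{b₀′})_{b₂}| ≤ C_α·(|x − x′|_∞/n)^α·e^{−δ|y(x) − y|_T}` — close pairs
(`|x − x′| ≤ ¼`) by §3 on test vectors supported in the block `y`, far pairs (`|x − x′|^{−α} ≤ 4`) by p22's block bound of `G^{(w′)}∇_λ*`
(1.110)₃ at both bonds. [cite: Balaban1984PropagatorsI, Prop. 1.2 (1.111) p.35; Balaban1984PropagatorsII, p.246 («They follow from the Proposition 1.2»)] -/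
theorem holderBound_GEDadj_scaling (d L : ℕ) (hd : 1 ≤ d + 1) (hL : Odd L ∧ 1 < L) {a : ℝ} (ha : 0 < a) :
    ∃ δ : ℝ, 0 < δ ∧ ∀ α : ℝ, 0 ≤ α → α < 1 → ∃ C : ℝ, 0 ≤ C ∧ ∀ (m K j : ℕ)
      (hj' : j ≤ (⟨d + 1, L, m, K, hd, hL⟩ : Params).m + (⟨d + 1, L, m, K, hd, hL⟩ : Params).K) (hc : ((L : ℝ) ^ j) ≠ 0)
      (hw' : (0 : ℝ) < a * ((L : ℝ) ^ j) ^ (d + 1)) (lam : Fin (d + 1))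
      (b₁ b₂ : PBond (⟨d + 1, L, m, K, hd, hL⟩ : Params) 0) (_hdir : b₁.dir = b₂.dir) (_hle : supDist b₁.src b₂.src ≤ L ^ j)
      (y : Site (⟨d + 1, L, m, K, hd, hL⟩ : Params) j),
      ∑ b₀' ∈ univ.filter (fun b₀' : PBond (⟨d + 1, L, m, K, hd, hL⟩ : Params) 0 => iterBlockOf j b₀'.src = y),
          |(GE (Domains.whole (P := (⟨d + 1, L, m, K, hd, hL⟩ : Params)) j hj') hc (w := fun _ => a * ((L : ℝ) ^ j) ^ (d + 1)) (fun _ => hw') ∘ₗ ((((L : ℝ) ^ j) • (onE (LinearMap.funLeft ℝ ℝ (fun b : PBond (⟨d + 1, L, m, K, hd, hL⟩ : Params) 0 => (⟨b.src.unshift lam, b.dir⟩ : PBond (⟨d + 1, L, m, K, hd, hL⟩ : Params) 0))) - LinearMap.id) : BondSpace (⟨d + 1, L, m, K, hd, hL⟩ : Params) →ₗ[ℝ] BondSpace (⟨d + 1, L, m, K, hd, hL⟩ : Params)))) (EuclideanSpace.single b₀' (1 : ℝ)) b₁ -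
           (GE (Domains.whole (P := (⟨d + 1, L, m, K, hd, hL⟩ : Params)) j hj') hc (w := fun _ => a * ((L : ℝ) ^ j) ^ (d + 1)) (fun _ => hw') ∘ₗ ((((L : ℝ) ^ j) • (onE (LinearMap.funLeft ℝ ℝ (fun b : PBond (⟨d + 1, L, m, K, hd, hL⟩ : Params) 0 => (⟨b.src.unshift lam, b.dir⟩ : PBond (⟨d + 1, L, m, K, hd, hL⟩ : Params) 0))) - LinearMap.id) : BondSpace (⟨d + 1, L, m, K, hd, hL⟩ : Params) →ₗ[ℝ] BondSpace (⟨d + 1, L, m, K, hd, hL⟩ : Params)))) (EuclideanSpace.single b₀' (1 : ℝ)) b₂| ≤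
        C * (((supDist b₁.src b₂.src : ℕ) : ℝ) / (L : ℝ) ^ j) ^ α * Real.exp (-(δ * torusSupNorm (Mk (⟨d + 1, L, m, K, hd, hL⟩ : Params) j)
            (rep (Mk (⟨d + 1, L, m, K, hd, hL⟩ : Params) j) (iterBlockOf j b₁.src) - rep (Mk (⟨d + 1, L, m, K, hd, hL⟩ : Params) j) y))) := by
  obtain ⟨δH, hδH, Cα, HH⟩ := h1L_allScales (d + 1) L ha
  obtain ⟨δS, hδS, CS, hCS, HS⟩ := blockBound_GEDadj_scaling d L hd hL ha
  refine ⟨min δH δS, lt_min hδH hδS, fun α hα0 hα1 => ?_⟩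
  have hLθ : 0 ≤ Lθ (d + 1) := Lθ_nonneg (d + 1)
  have hm : 0 ≤ max (Cα α) 0 := le_max_right _ _
  refine ⟨max (Cα α) 0 * (Lθ (d + 1) + 1) * Real.exp (3 * δH) + 4 * CS * (1 + Real.exp δS), by positivity, ?_⟩
  intro m K j hj' hc hw' lam b₁ b₂ hdir hle y
  have hL0 : 0 < L := by have := hL.2; omega
  haveI : NeZero L := ⟨by omega⟩
  have hLj : (0 : ℝ) < (L : ℝ) ^ j := by positivity
  have hρ : IsPseudoDist (fun t t' : Site (⟨d + 1, L, m, K, hd, hL⟩ : Params) j => torusSupNorm (Mk (⟨d + 1, L, m, K, hd, hL⟩ : Params) j) (rep (Mk (⟨d + 1, L, m, K, hd, hL⟩ : Params) j) t - rep (Mk (⟨d + 1, L, m, K, hd, hL⟩ : Params) j) t')) := torusDist_isPseudoDist (Mk (⟨d + 1, L, m, K, hd, hL⟩ : Params) j)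
  have hD0 : 0 ≤ torusSupNorm (Mk (⟨d + 1, L, m, K, hd, hL⟩ : Params) j)
            (rep (Mk (⟨d + 1, L, m, K, hd, hL⟩ : Params) j) (iterBlockOf j b₁.src) - rep (Mk (⟨d + 1, L, m, K, hd, hL⟩ : Params) j) y) := hρ.nonneg _ _
  set t : ℝ := (((supDist b₁.src b₂.src : ℕ) : ℝ) / (L : ℝ) ^ j) with ht
  have ht0 : 0 ≤ t := by positivity
  have ht1 : t ≤ 1 := by rw [ht, div_le_one hLj]; exact_mod_cast hle
  have htα : 0 ≤ t ^ α := Real.rpow_nonneg ht0 α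
  have hdU : distU (L ^ j) (Mk (⟨d + 1, L, m, K, hd, hL⟩ : Params) j) (EK hj' b₁.src) (EK hj' b₂.src) = t := by rw [ht]; exact distU_EK hj' b₁.src b₂.src
  have hmin0 : 0 ≤ min δH δS := (lt_min hδH hδS).le
  -- weakening to the common rate and constant
  have weak : ∀ {Cb δb : ℝ}, 0 ≤ Cb → Cb ≤ max (Cα α) 0 * (Lθ (d + 1) + 1) * Real.exp (3 * δH) + 4 * CS * (1 + Real.exp δS) →
      min δH δS ≤ δb →
      Cb * t ^ α * Real.exp (-(δb * torusSupNorm (Mk (⟨d + 1, L, m, K, hd, hL⟩ : Params) j)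
            (rep (Mk (⟨d + 1, L, m, K, hd, hL⟩ : Params) j) (iterBlockOf j b₁.src) - rep (Mk (⟨d + 1, L, m, K, hd, hL⟩ : Params) j) y))) ≤
        (max (Cα α) 0 * (Lθ (d + 1) + 1) * Real.exp (3 * δH) + 4 * CS * (1 + Real.exp δS)) * t ^ α *
          Real.exp (-(min δH δS * torusSupNorm (Mk (⟨d + 1, L, m, K, hd, hL⟩ : Params) j)
            (rep (Mk (⟨d + 1, L, m, K, hd, hL⟩ : Params) j) (iterBlockOf j b₁.src) - rep (Mk (⟨d + 1, L, m, K, hd, hL⟩ : Params) j) y))) := by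
    intro Cb δb hCb hCC hδδ
    have h1 : Real.exp (-(δb * torusSupNorm (Mk (⟨d + 1, L, m, K, hd, hL⟩ : Params) j)
            (rep (Mk (⟨d + 1, L, m, K, hd, hL⟩ : Params) j) (iterBlockOf j b₁.src) - rep (Mk (⟨d + 1, L, m, K, hd, hL⟩ : Params) j) y))) ≤ Real.exp (-(min δH δS * torusSupNorm (Mk (⟨d + 1, L, m, K, hd, hL⟩ : Params) j)
            (rep (Mk (⟨d + 1, L, m, K, hd, hL⟩ : Params) j) (iterBlockOf j b₁.src) - rep (Mk (⟨d + 1, L, m, K, hd, hL⟩ : Params) j) y))) := Real.exp_le_exp.2 (by nlinarith)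
    exact mul_le_mul (mul_le_mul_of_nonneg_right hCC htα) h1 (Real.exp_pos _).le (by positivity)
  by_cases h0 : supDist b₁.src b₂.src = 0
  · -- `b₁ = b₂`: nothing to prove
    have hb : b₁ = b₂ := by
      have hs : b₁.src = b₂.src := (supDist_eq_zero_iff _ _).1 h0
      cases b₁; cases b₂
      simp only at hs hdir
      subst hs; subst hdir; rfl
    subst hb
    simp only [sub_self, abs_zero, Finset.sum_const_zero]
    positivity
  have hpos : 0 < t := by rw [ht]; exact div_pos (by exact_mod_cast Nat.pos_of_ne_zero h0) hLj
  by_cases hsm : t ≤ 1 / 4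
  · -- CLOSE PAIRS: `n ≥ 4`, so `j ≥ 1`, and §3 applies on test vectors supported in the block `y`
    have hj1 : 1 ≤ j := by
      by_contra hj0
      have hj0' : j = 0 := by omega
      have h1t : (1 : ℝ) ≤ t := by
        rw [ht, hj0', pow_zero, div_one]
        exact_mod_cast Nat.pos_of_ne_zero h0
      linarith
    have hsmall : ∑ b₀' ∈ univ.filter (fun b₀' : PBond (⟨d + 1, L, m, K, hd, hL⟩ : Params) 0 => iterBlockOf j b₀'.src = y),
          |(GE (Domains.whole (P := (⟨d + 1, L, m, K, hd, hL⟩ : Params)) j hj') hc (w := fun _ => a * ((L : ℝ) ^ j) ^ (d + 1)) (fun _ => hw') ∘ₗ ((((L : ℝ) ^ j) • (onE (LinearMap.funLeft ℝ ℝ (fun b : PBond (⟨d + 1, L, m, K, hd, hL⟩ : Params) 0 => (⟨b.src.unshift lam, b.dir⟩ : PBond (⟨d + 1, L, m, K, hd, hL⟩ : Params) 0))) - LinearMap.id) : BondSpace (⟨d + 1, L, m, K, hd, hL⟩ : Params) →ₗ[ℝ] BondSpace (⟨d + 1, L, m, K, hd, hL⟩ : Params)))) (EuclideanSpace.single b₀'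 (1 : ℝ)) b₁ -
           (GE (Domains.whole (P := (⟨d + 1, L, m, K, hd, hL⟩ : Params)) j hj') hc (w := fun _ => a * ((L : ℝ) ^ j) ^ (d + 1)) (fun _ => hw') ∘ₗ ((((L : ℝ) ^ j) • (onE (LinearMap.funLeft ℝ ℝ (fun b : PBond (⟨d + 1, L, m, K, hd, hL⟩ : Params) 0 => (⟨b.src.unshift lam, b.dir⟩ : PBond (⟨d + 1, L, m, K, hd, hL⟩ : Params) 0))) - LinearMap.id) : BondSpace (⟨d + 1, L, m, K, hd, hL⟩ : Params) →ₗ[ℝ] BondSpace (⟨d + 1, L, m, K, hd, hL⟩ : Params)))) (EuclideanSpace.single b₀' (1 : ℝ)) b₂| ≤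
        max (Cα α) 0 * (Lθ (d + 1) + 1) * Real.exp (3 * δH) * t ^ α * Real.exp (-(δH * torusSupNorm (Mk (⟨d + 1, L, m, K, hd, hL⟩ : Params) j)
            (rep (Mk (⟨d + 1, L, m, K, hd, hL⟩ : Params) j) (iterBlockOf j b₁.src) - rep (Mk (⟨d + 1, L, m, K, hd, hL⟩ : Params) j) y))) := by
      refine holderBound_of_cubeSup _ (fun b₀ : PBond (⟨d + 1, L, m, K, hd, hL⟩ : Params) 0 => iterBlockOf j b₀.src) b₁ b₂ y (fun x hsupp hx => ?_)
      have h := abs_GE_Dadj_sub_le_close hj' hc ha hw' hδH.le hα0 hα1 (HH (⟨d + 1, L, m, K, hd, hL⟩ : Params) rfl rfl j hj1 hj') lam x zero_le_one y hsupp hx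
        b₁ b₂ hdir (by rw [hdU]; exact hpos) (by rw [hdU]; exact hsm)
      rw [hdU] at h
      refine h.trans (le_of_eq ?_)
      ring
    refine hsmall.trans (weak (by positivity) ?_ (min_le_left _ _))
    have : 0 ≤ 4 * CS * (1 + Real.exp δS) := by positivity
    linarith
  · -- FAR PAIRS (`¼ < t ≤ 1`): (1.110)₃ at both bonds, `t^{−α} ≤ 4`
    have hs : torusSupNorm (Mk (⟨d + 1, L, m, K, hd, hL⟩ : Params) j) (rep (Mk (⟨d + 1, L, m, K, hd, hL⟩ : Params) j) (iterBlockOf j b₁.src) - rep (Mk (⟨d + 1, L, m, K, hd, hL⟩ : Params) j) (iterBlockOf j b₂.src)) ≤ 1 := by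
      rw [← supDist_cast_eq_torusSupNorm]
      exact_mod_cast supDist_blk_le_one hj' b₁.src b₂.src hle
    have hfar := holderBound_of_blockBound (ρ := (fun t t' : Site (⟨d + 1, L, m, K, hd, hL⟩ : Params) j => torusSupNorm (Mk (⟨d + 1, L, m, K, hd, hL⟩ : Params) j) (rep (Mk (⟨d + 1, L, m, K, hd, hL⟩ : Params) j) t - rep (Mk (⟨d + 1, L, m, K, hd, hL⟩ : Params) j) t'))) hρ _ (fun b₀ : PBond (⟨d + 1, L, m, K, hd, hL⟩ : Params) 0 => iterBlockOf j b₀.src)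
      (fun b₀ : PBond (⟨d + 1, L, m, K, hd, hL⟩ : Params) 0 => iterBlockOf j b₀.src) b₁ b₂ hCS hδS.le hs (HS m K j hj' hc hw' lam) y
    refine hfar.trans ?_
    have htq : 1 / 4 < t := lt_of_not_ge hsm
    have h4 : (1 : ℝ) ≤ 4 * t ^ α := by
      have h1 : t ≤ t ^ α := self_le_rpow_of_le_one' ht0 ht1 hα1.le
      linarith
    have key : CS * (1 + Real.exp (δS * 1)) ≤ 4 * CS * (1 + Real.exp δS) * t ^ α := by
      rw [mul_one]
      have h1 : CS * (1 + Real.exp δS) * 1 ≤ CS * (1 + Real.exp δS) * (4 * t ^ α) :=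
        mul_le_mul_of_nonneg_left h4 (by positivity)
      linarith
    refine (mul_le_mul_of_nonneg_right key (Real.exp_pos _).le).trans (weak (by positivity) ?_ (min_le_right _ _))
    have : 0 ≤ max (Cα α) 0 * (Lθ (d + 1) + 1) * Real.exp (3 * δH) := by positivity
    linarith

end Literature.MathematicalPhysics.QuantumFieldTheory.Balaban1983to89.B6BlockHolderGDivGEV1

end
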